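import Literature.NumberTheory.Sieve.MatomakiRadziwillProp1Ej
import HarnessLib

/-!
# Matomäki–Radziwiłł 2016, Proposition 1 for general coefficients — (c) `E_j`, `j ≥ 2` (§8.2)

Topic `NumberTheory/Sieve`.  Everything in this file is PROVED; no definitions, no named facts.

General-coefficient form of `MatomakiRadziwillProp1Ej.lean` (K. Matomäki, M. Radziwiłł, *Multiplicative functions in
short intervals*, Ann. of Math. 183 (2016), §8.2): the prime-block polynomials `Q_{v,H_j}` have arbitrary `1`-bounded
coefficients `c` and the cofactor polynomials `R_{v,H_j}` arbitrary `1`-bounded coefficients `b` (in the tree file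
`c_p = f(p)`, `b = f 1_{𝒮_j}` for a real multiplicative `f`; only `|c|, |b| ≤ 1` are used), and the summation range `X`
is any real `≥ 1`, independent of the interval system's parameter `X₀` (`I : SieveIntervalSystem η X₀`).  This is
the form needed for complex `f` in Matomäki–Radziwiłł–Tao 2015, Appendix A (proof of Proposition A.3, range `𝒯₂`).
The proofs are those of the tree file verbatim (Lemma 13 enters as the hypothesis `h13`, as there):

* `integral_Tsub_le_coef`, `integral_Tsub_le_coef'` — §8.2 on one piece `𝒯_{j,r}`;
* `E_j_le_coef` — `C₁₂ H_j log(Q_j/P_j) ∑_{v∈ℐ_j} ∫_{𝒯_j} |Q_{v,H_j} R_{v,H_j}|² ≤ 10⁸ max(C₁₃,0) (T/X + 1)/(j² Q_{j-1})`.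

## References
* K. Matomäki, M. Radziwiłł, Ann. of Math. (2) 183 (2016), 1015–1056 (arXiv:1501.04585), §8.2.
  [cite: MatomakiRadziwillAnnals2016, §8.2]
* K. Matomäki, M. Radziwiłł, T. Tao, Algebra & Number Theory 9 (2015), Appendix A, Proposition A.3 (proof).
  [cite: MatomakiRadziwillTao2015, Appendix A, Proposition A.3 (proof)]
-/

noncomputable section

open Finset Complex MeasureTheory

namespace Literature.NumberTheory.Sieve

namespace SieveIntervalSystem

variable {η X₀ : ℝ} (I : SieveIntervalSystem η X₀)

/-- **§8.2, analytic part**: for `j ≥ 2`, `r ∈ ℐ_{j-1}`, `v ∈ ℐ_j`, with `ℓ = ⌈(v/H_j)/(r/H_{j-1})⌉`,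
`Y₁ = e^{r/H_{j-1}} ≥ 2`, `H_{j-1} ≥ 2`, `X, T ≥ 1`, `T₀ ≥ 0` and the constant `C₁₃` of Lemma 13:
`∫_{𝒯_{j,r}} |Q_{v,H_j} R_{v,H_j}|² ≤ e^{-2α_j v/H_j} e^{2ℓ α_{j-1} r/H_{j-1}} · max(C₁₃,0) (T/X + 2^ℓ Y₁) ((ℓ+1)!)²`
("multiplying by `(|Q_{r,H_{j-1}}| e^{α_{j-1}r/H_{j-1}})^{2ℓ} ≥ 1` … Now we are in the position to use Lemma 13").
[cite: MatomakiRadziwillAnnals2016, §8.2] -/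
theorem integral_Tsub_le_coef {C₁₃ : ℝ}
    (h13 : ∀ (X T Y₁ Y₂ : ℝ) (a c : ℕ → ℂ), 1 ≤ X → 1 ≤ T → 2 ≤ Y₁ → 1 ≤ Y₂ →
      (∀ m, ‖a m‖ ≤ 1) → (∀ p, ‖c p‖ ≤ 1) →
      ∫ t in (-T)..T,
          ‖(∑ p ∈ (Icc ⌈Y₁⌉₊ ⌊2 * Y₁⌋₊).filter Nat.Prime, c p * (p : ℂ) ^ (-(1 + (t : ℂ) * Complex.I)))
                ^ ⌈Real.log Y₂ / Real.log Y₁⌉₊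
            * ∑ m ∈ Icc ⌈X / Y₂⌉₊ ⌊2 * X / Y₂⌋₊, a m * (m : ℂ) ^ (-(1 + (t : ℂ) * Complex.I))‖ ^ 2 ≤
        C₁₃ * (T / X + 2 ^ ⌈Real.log Y₂ / Real.log Y₁⌉₊ * Y₁)
          * ((⌈Real.log Y₂ / Real.log Y₁⌉₊ + 1).factorial : ℝ) ^ 2)
    (c b : ℕ → ℂ) (hc : ∀ p, ‖c p‖ ≤ 1) (hb : ∀ m, ‖b m‖ ≤ 1) {X : ℝ} (hX : 1 ≤ X) {T₀ T : ℝ} (hT₀ : 0 ≤ T₀)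
    (hT : 1 ≤ T) (j : ℕ) (hH : 2 ≤ I.Hpar (j - 1)) (hHj : 0 < I.Hpar j) {r v : ℕ}
    (hv : v ∈ I.blocks j) (hY₁ : 2 ≤ Real.exp ((r : ℝ) / I.Hpar (j - 1))) :
    ∫ t in I.Tsub c T₀ T j r,
        ‖blockPrimePoly c (I.P j) (I.Q j) (I.Hpar j) v t *
          blockCofactorPoly (b) X (I.P j) (I.Q j) (I.Hpar j) v t‖ ^ 2 ≤
      Real.exp (-(2 * alpha η j * ((v : ℝ) / I.Hpar j))) *
        Real.exp (2 * ⌈((v : ℝ) / I.Hpar j) / ((r : ℝ) / I.Hpar (j - 1))⌉₊ *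
          (alpha η (j - 1) * ((r : ℝ) / I.Hpar (j - 1)))) *
        (max C₁₃ 0 * (T / X + 2 ^ ⌈((v : ℝ) / I.Hpar j) / ((r : ℝ) / I.Hpar (j - 1))⌉₊ *
            Real.exp ((r : ℝ) / I.Hpar (j - 1))) *
          ((⌈((v : ℝ) / I.Hpar j) / ((r : ℝ) / I.Hpar (j - 1))⌉₊ + 1).factorial : ℝ) ^ 2) := by
  set ℓ := ⌈((v : ℝ) / I.Hpar j) / ((r : ℝ) / I.Hpar (j - 1))⌉₊ with hℓdef
  set Qv : ℝ → ℂ := fun t => blockPrimePoly c (I.P j) (I.Q j) (I.Hpar j) v t with hQv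
  set Rv : ℝ → ℂ := fun t => blockCofactorPoly (b) X (I.P j) (I.Q j) (I.Hpar j) v t with hRv
  set Qr : ℝ → ℂ := fun t => blockPrimePoly c (I.P (j - 1)) (I.Q (j - 1)) (I.Hpar (j - 1)) r t with hQr
  set e₁ := Real.exp (-(2 * alpha η j * ((v : ℝ) / I.Hpar j))) with he₁
  set e₂ := Real.exp (2 * ℓ * (alpha η (j - 1) * ((r : ℝ) / I.Hpar (j - 1)))) with he₂
  have hT0 : 0 < T := by linarith
  have hsubT : I.Tsub c T₀ T j r ⊆ Set.Icc (-T) T :=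
    ((I.Tsub_subset c T₀ T j r).trans (I.Tset_subset c T₀ T j)).trans
      (Set.Icc_subset_Icc (by linarith) le_rfl)
  -- pointwise bound on `𝒯_{j,r}`
  have hpt : ∀ t ∈ I.Tsub c T₀ T j r, ‖Qv t * Rv t‖ ^ 2 ≤ e₁ * e₂ * ‖Qr t ^ ℓ * Rv t‖ ^ 2 := by
    intro t ht
    have hgood : t ∈ I.goodSet c j := (I.Tsub_subset c T₀ T j r ht).1.2
    have hQv1 : ‖Qv t‖ ≤ Real.exp (-(alpha η j * v / I.Hpar j)) := by
      unfold goodSet at hgood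
      exact Set.mem_iInter₂.1 hgood v hv
    have hamp := I.norm_sq_le_on_Tsub c T₀ T ht (Rv t) ℓ
    have he₂' : Real.exp (2 * ℓ * (alpha η (j - 1) * r / I.Hpar (j - 1))) = e₂ := by
      rw [he₂, mul_div_assoc]
    rw [he₂'] at hamp
    have he₁' : Real.exp (-(alpha η j * v / I.Hpar j)) ^ 2 = e₁ := by
      rw [he₁, ← Real.exp_nat_mul]; congr 1; push_cast; ring
    rw [norm_mul, mul_pow]
    calc ‖Qv t‖ ^ 2 * ‖Rv t‖ ^ 2 ≤ Real.exp (-(alpha η j * v / I.Hpar j)) ^ 2 * (e₂ * ‖Qr t ^ ℓ * Rv t‖ ^ 2) :=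
          mul_le_mul (pow_le_pow_left₀ (norm_nonneg _) hQv1 2) hamp (sq_nonneg _) (sq_nonneg _)
      _ = e₁ * e₂ * ‖Qr t ^ ℓ * Rv t‖ ^ 2 := by rw [he₁']; ring
  -- continuity / integrability
  have hcQv : Continuous Qv := by
    rw [hQv]; unfold blockPrimePoly; exact MatomakiRadziwillLemma12.continuous_dsum _ _
  have hcQr : Continuous Qr := by
    rw [hQr]; unfold blockPrimePoly; exact MatomakiRadziwillLemma12.continuous_dsum _ _
  have hcRv : Continuous Rv := by
    rw [hRv]; unfold blockCofactorPoly
    exact continuous_finsetSum _ fun m _ =>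
      (continuous_const.mul (MatomakiRadziwillLemma12.continuous_cpw m)).div_const _
  have hcG : Continuous fun t => ‖Qr t ^ ℓ * Rv t‖ ^ 2 := ((hcQr.pow ℓ).mul hcRv).norm.pow 2
  have hi1 : IntegrableOn (fun t => ‖Qv t * Rv t‖ ^ 2) (I.Tsub c T₀ T j r) :=
    MatomakiRadziwillLemma12.integrableOn_of_continuous ((hcQv.mul hcRv).norm.pow 2) hsubT
  have hi2 : IntegrableOn (fun t => e₁ * e₂ * ‖Qr t ^ ℓ * Rv t‖ ^ 2) (I.Tsub c T₀ T j r) :=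
    MatomakiRadziwillLemma12.integrableOn_of_continuous (continuous_const.mul hcG) hsubT
  -- Lemma 13
  have hL13 := lemma13_block h13 hb hc hX hT
    (I.P (j - 1)) (I.Q (j - 1)) (I.P j) (I.Q j) hH hHj r v hY₁
  have hmax : C₁₃ * (T / X + 2 ^ ℓ * Real.exp ((r : ℝ) / I.Hpar (j - 1))) *
      ((ℓ + 1).factorial : ℝ) ^ 2 ≤
      max C₁₃ 0 * (T / X + 2 ^ ℓ * Real.exp ((r : ℝ) / I.Hpar (j - 1))) *
        ((ℓ + 1).factorial : ℝ) ^ 2 := by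
    have h0 : 0 ≤ (T / X + 2 ^ ℓ * Real.exp ((r : ℝ) / I.Hpar (j - 1))) *
        ((ℓ + 1).factorial : ℝ) ^ 2 := by positivity
    have := mul_le_mul_of_nonneg_right (le_max_left C₁₃ 0) h0
    simpa [mul_assoc] using this
  calc ∫ t in I.Tsub c T₀ T j r, ‖Qv t * Rv t‖ ^ 2
      ≤ ∫ t in I.Tsub c T₀ T j r, e₁ * e₂ * ‖Qr t ^ ℓ * Rv t‖ ^ 2 :=
        setIntegral_mono_on hi1 hi2 (I.measurableSet_Tsub c T₀ T j r) hpt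
    _ = e₁ * e₂ * ∫ t in I.Tsub c T₀ T j r, ‖Qr t ^ ℓ * Rv t‖ ^ 2 := integral_const_mul _ _
    _ ≤ e₁ * e₂ * ∫ t in (-T)..T, ‖Qr t ^ ℓ * Rv t‖ ^ 2 :=
        mul_le_mul_of_nonneg_left
          (MatomakiRadziwillLemma12.setIntegral_le_intervalIntegral hcG (fun t => by positivity) hT0 hsubT)
          (by positivity)
    _ ≤ e₁ * e₂ * (max C₁₃ 0 * (T / X + 2 ^ ℓ * Real.exp ((r : ℝ) / I.Hpar (j - 1))) *
          ((ℓ + 1).factorial : ℝ) ^ 2) :=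
        mul_le_mul_of_nonneg_left (hL13.trans hmax) (by positivity)

/-- **§8.2, the bound for one pair `(r, v)`**: for `j ≥ 2`, `0 < η < 1/6`, `H₁ ≥ 2`, `r ∈ ℐ_{j-1}`,
`v ∈ ℐ_j`, `X, T ≥ 1`, `T₀ ≥ 0`:
`∫_{𝒯_{j,r}} |Q_{v,H_j} R_{v,H_j}|² ≤ max(C₁₃,0) (T/X + 1) e⁷ j^{-8} Q_{j-1}^{-59/24}`
(the printed chain `≪ (T/X + 1) Q_{j-1} (log Q_j)² exp((η/(2j²)) v/H_j)` for the moment, times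
`exp(2v(α_{j-1}-α_j)/H_j + 2α_{j-1} r/H_{j-1})`, made explicit with `exponent_bound`, (2) and (3)).
[cite: MatomakiRadziwillAnnals2016, §8.2] -/
theorem integral_Tsub_le_coef' {C₁₃ : ℝ}
    (h13 : ∀ (X T Y₁ Y₂ : ℝ) (a c : ℕ → ℂ), 1 ≤ X → 1 ≤ T → 2 ≤ Y₁ → 1 ≤ Y₂ →
      (∀ m, ‖a m‖ ≤ 1) → (∀ p, ‖c p‖ ≤ 1) →
      ∫ t in (-T)..T,
          ‖(∑ p ∈ (Icc ⌈Y₁⌉₊ ⌊2 * Y₁⌋₊).filter Nat.Prime, c p * (p : ℂ) ^ (-(1 + (t : ℂ) * Complex.I)))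
                ^ ⌈Real.log Y₂ / Real.log Y₁⌉₊
            * ∑ m ∈ Icc ⌈X / Y₂⌉₊ ⌊2 * X / Y₂⌋₊, a m * (m : ℂ) ^ (-(1 + (t : ℂ) * Complex.I))‖ ^ 2 ≤
        C₁₃ * (T / X + 2 ^ ⌈Real.log Y₂ / Real.log Y₁⌉₊ * Y₁)
          * ((⌈Real.log Y₂ / Real.log Y₁⌉₊ + 1).factorial : ℝ) ^ 2)
    (hη : 0 < η) (hη6 : η < 1 / 6) (c b : ℕ → ℂ) (hc : ∀ p, ‖c p‖ ≤ 1) (hb : ∀ m, ‖b m‖ ≤ 1) {X : ℝ} (hX : 1 ≤ X)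
    {T₀ T : ℝ} (hT₀ : 0 ≤ T₀) (hT : 1 ≤ T) {j : ℕ} (hj : 2 ≤ j) (hH1 : 2 ≤ I.Hpar 1)
    {r v : ℕ} (hr : r ∈ I.blocks (j - 1)) (hv : v ∈ I.blocks j) :
    ∫ t in I.Tsub c T₀ T j r,
        ‖blockPrimePoly c (I.P j) (I.Q j) (I.Hpar j) v t *
          blockCofactorPoly (b) X (I.P j) (I.Q j) (I.Hpar j) v t‖ ^ 2 ≤
      max C₁₃ 0 * (T / X + 1) * (Real.exp 7 / (j : ℝ) ^ 8 * I.Q (j - 1) ^ (-(59 / 24) : ℝ)) := by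
  have hη' : η ≤ 8 := by linarith
  have hη'' : η ≤ 1 / 6 := hη6.le
  have hj1 : 1 ≤ j - 1 := by omega
  have hj2 : (2 : ℝ) ≤ j := by exact_mod_cast hj
  -- sizes of the parameters
  have hHi : 2 ≤ I.Hpar (j - 1) := hH1.trans (I.Hpar_one_le hη hη' hj1)
  have hHi0 : 0 < I.Hpar (j - 1) := by linarith
  have hHj1 : 1 ≤ I.Hpar j := by linarith [I.Hpar_one_le hη hη' (show 1 ≤ j by omega)]
  have hHj0 : 0 < I.Hpar j := by linarith
  have hA : 0 < I.Q (j - 1) := I.pos_Q hj1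
  have hA1 : 1 ≤ I.Q (j - 1) := I.one_le_Q hη hη' hj1
  have hlogA : 1 < Real.log (I.Q (j - 1)) := I.one_lt_logQ hη hη'' hj1
  have hPj : 0 < I.P j := I.pos_P j (by omega)
  have hlogPi : 2 ≤ Real.log (I.P (j - 1)) := I.two_le_logP hη hη'' hj1
  have hX0 : 0 < X := by linarith
  have hT0 : 0 < T := by linarith
  -- `x = v/H_j`, `y = r/H_{j-1}`, `y₀ = log P_{j-1} - 1`, `L = log Q_j`, `L' = log Q_{j-1}`
  set x := (v : ℝ) / I.Hpar j with hx
  set y := (r : ℝ) / I.Hpar (j - 1) with hy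
  have hy₀y : Real.log (I.P (j - 1)) - 1 ≤ y := by
    have h := I.Hpar_mul_log_P_lt hr
    rw [hy, le_div_iff₀ hHi0]
    have hid : (Real.log (I.P (j - 1)) - 1) * I.Hpar (j - 1) =
        I.Hpar (j - 1) * Real.log (I.P (j - 1)) - I.Hpar (j - 1) := by ring
    linarith only [h, hid, hHi]
  have hyL' : y ≤ Real.log (I.Q (j - 1)) := by
    have hlogQ : 0 ≤ I.Hpar (j - 1) * Real.log (I.Q (j - 1)) := by positivity
    have hr' : (r : ℝ) ≤ I.Hpar (j - 1) * Real.log (I.Q (j - 1)) :=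
      (Nat.le_floor_iff hlogQ).1 (mem_Icc.1 (by unfold blocks at hr; exact hr)).2
    rw [hy, div_le_iff₀ hHi0]; linarith
  have hxL : x ≤ Real.log (I.Q j) := by
    have hlogQj : 0 ≤ Real.log (I.Q j) := (I.one_lt_logQ hη hη'' (by omega)).le.trans' zero_le_one
    have hlogQ : 0 ≤ I.Hpar j * Real.log (I.Q j) := by positivity
    have hv' : (v : ℝ) ≤ I.Hpar j * Real.log (I.Q j) :=
      (Nat.le_floor_iff hlogQ).1 (mem_Icc.1 (by unfold blocks at hv; exact hv)).2
    rw [hx, div_le_iff₀ hHj0]; linarith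
  have hxP : Real.log (I.P j) - 1 ≤ x := by
    have h := I.Hpar_mul_log_P_lt hv
    rw [hx, le_div_iff₀ hHj0]
    have hid : (Real.log (I.P j) - 1) * I.Hpar j = I.Hpar j * Real.log (I.P j) - I.Hpar j := by ring
    linarith only [h, hid, hHj1]
  have hyx : y ≤ x := by
    -- `log P_j ≥ (8j²/η) log Q_{j-1} ≥ log Q_{j-1} + 1`
    have h3 := I.notTooClose j hj
    have hlogj : 0 ≤ Real.log (j : ℝ) := Real.log_nonneg (by linarith)
    have hj4 : (4 : ℝ) ≤ (j : ℝ) ^ 2 := by nlinarith only [hj2]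
    have hc : η / (j : ℝ) ^ 2 ≤ 1 := by
      rw [div_le_one (by positivity)]; linarith only [hη6, hj4]
    have hlogPj : 0 < Real.log (I.P j) := by
      have : 0 < η / (j : ℝ) ^ 2 * Real.log (I.P j) := by linarith only [h3, hlogA, hlogj]
      exact pos_of_mul_pos_right this (by positivity)
    have : 8 * Real.log (I.Q (j - 1)) ≤ Real.log (I.P j) := by
      calc 8 * Real.log (I.Q (j - 1)) ≤ η / (j : ℝ) ^ 2 * Real.log (I.P j) := by
            linarith only [h3, hlogj]
        _ ≤ 1 * Real.log (I.P j) := mul_le_mul_of_nonneg_right hc hlogPj.le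
        _ = Real.log (I.P j) := one_mul _
    linarith
  -- the exponent bookkeeping
  have hexp := exponent_bound hη hη6 hj (by linarith) hy₀y hyL' hyx hxL (I.notTooFar j hj)
    (I.four_div_logP_sub_one_le hη hη'' hj)
  -- the analytic bound
  have hY₁ : 2 ≤ Real.exp y := by
    have : Real.log 2 ≤ y := by
      have := Real.log_two_lt_d9
      linarith
    calc (2 : ℝ) = Real.exp (Real.log 2) := (Real.exp_log two_pos).symm
      _ ≤ Real.exp y := Real.exp_le_exp.2 this
  have hmain := I.integral_Tsub_le_coef h13 c b hc hb hX hT₀ hT j hHi hHj0 hv hY₁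
  -- sizes: `e^y ≤ Q_{j-1}`, `e^{L'/2} = Q_{j-1}^{1/2}`, `L⁴ ≤ Q_{j-1}^{4/96}`, `e^{-(η/2j²)x} ≤ e^{1/48}/(Q_{j-1}⁴ j⁸)`
  have hey : Real.exp y ≤ I.Q (j - 1) := I.exp_div_Hpar_le hη hη' hj1 hr hHi0
  have heL' : Real.exp (Real.log (I.Q (j - 1)) / 2) = I.Q (j - 1) ^ (1 / 2 : ℝ) := by
    rw [Real.rpow_def_of_pos hA]; congr 1; ring
  have hL4 : Real.log (I.Q j) ^ 4 ≤ I.Q (j - 1) ^ (4 / 96 : ℝ) := by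
    have h := I.logQ_le_Q_pred_rpow hη hη'' hj
    have h0 : 0 ≤ Real.log (I.Q j) := by linarith [hyx.trans hxL, hy₀y]
    calc Real.log (I.Q j) ^ 4 ≤ (I.Q (j - 1) ^ (1 / 96 : ℝ)) ^ 4 := pow_le_pow_left₀ h0 h 4
      _ = I.Q (j - 1) ^ (4 / 96 : ℝ) := by
          rw [← Real.rpow_natCast, ← Real.rpow_mul hA.le]; norm_num
  have hex : Real.exp (-(η / (2 * (j : ℝ) ^ 2) * x)) ≤ Real.exp (1 / 48) * ((I.Q (j - 1) ^ 4 * (j : ℝ) ^ 8))⁻¹ := by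
    have h3 := I.Q_pow_four_mul_le hη hj
    have hj4 : (4 : ℝ) ≤ (j : ℝ) ^ 2 := by nlinarith only [hj2]
    have hc : η / (2 * (j : ℝ) ^ 2) ≤ 1 / 48 := by
      rw [div_le_div_iff₀ (by positivity) (by norm_num)]; linarith only [hη6, hj4]
    have hc0 : 0 < η / (2 * (j : ℝ) ^ 2) := by positivity
    have h1 : -(η / (2 * (j : ℝ) ^ 2) * x) ≤ 1 / 48 + -(η / (2 * (j : ℝ) ^ 2) * Real.log (I.P j)) := by
      have h2 := mul_le_mul_of_nonneg_left hxP hc0.le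
      have hid : η / (2 * (j : ℝ) ^ 2) * (Real.log (I.P j) - 1) =
          η / (2 * (j : ℝ) ^ 2) * Real.log (I.P j) - η / (2 * (j : ℝ) ^ 2) := by ring
      linarith only [h2, hid, hc]
    have hpos : 0 < I.Q (j - 1) ^ 4 * (j : ℝ) ^ 8 := by positivity
    calc Real.exp (-(η / (2 * (j : ℝ) ^ 2) * x))
        ≤ Real.exp (1 / 48 + -(η / (2 * (j : ℝ) ^ 2) * Real.log (I.P j))) := Real.exp_le_exp.2 h1
      _ = Real.exp (1 / 48) * (I.P j ^ (η / (2 * (j : ℝ) ^ 2)))⁻¹ := by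
          rw [Real.exp_add, Real.exp_neg, Real.rpow_def_of_pos hPj, mul_comm (Real.log (I.P j))]
      _ ≤ Real.exp (1 / 48) * (I.Q (j - 1) ^ 4 * (j : ℝ) ^ 8)⁻¹ := by
          gcongr
  -- assemble
  set ℓ := ⌈x / y⌉₊ with hℓ
  set F := ((2 : ℝ) ^ ℓ * (((ℓ + 1).factorial : ℕ) : ℝ) ^ 2) with hF
  have hF1 : 1 ≤ (2 : ℝ) ^ ℓ * Real.exp y := by
    have h1 : (1 : ℝ) ≤ 2 ^ ℓ := one_le_pow₀ (by norm_num)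
    have h2 : 1 ≤ Real.exp y := by linarith
    exact one_le_mul_of_one_le_of_one_le h1 h2
  have hstep1 : max C₁₃ 0 * (T / X + 2 ^ ℓ * Real.exp y) * (((ℓ + 1).factorial : ℕ) : ℝ) ^ 2 ≤
      max C₁₃ 0 * (T / X + 1) * Real.exp y * F := by
    have hTX : 0 ≤ T / X := by positivity
    have h1 : T / X + 2 ^ ℓ * Real.exp y ≤ (T / X + 1) * (2 ^ ℓ * Real.exp y) := by
      nlinarith only [hTX, hF1]
    calc max C₁₃ 0 * (T / X + 2 ^ ℓ * Real.exp y) * (((ℓ + 1).factorial : ℕ) : ℝ) ^ 2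
        ≤ max C₁₃ 0 * ((T / X + 1) * (2 ^ ℓ * Real.exp y)) * (((ℓ + 1).factorial : ℕ) : ℝ) ^ 2 := by
          gcongr
      _ = max C₁₃ 0 * (T / X + 1) * Real.exp y * F := by rw [hF]; ring
  have hmain' : ∫ t in I.Tsub c T₀ T j r,
      ‖blockPrimePoly c (I.P j) (I.Q j) (I.Hpar j) v t *
        blockCofactorPoly (b) X (I.P j) (I.Q j) (I.Hpar j) v t‖ ^ 2 ≤
      max C₁₃ 0 * (T / X + 1) * Real.exp y *
        (Real.exp (-(2 * alpha η j * x)) * Real.exp (2 * ℓ * (alpha η (j - 1) * y)) * F) := by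
    refine hmain.trans ?_
    have := mul_le_mul_of_nonneg_left hstep1
      (mul_nonneg (Real.exp_pos (-(2 * alpha η j * x))).le
        (Real.exp_pos (2 * ℓ * (alpha η (j - 1) * y))).le)
    linarith only [this]
  have hexp' : Real.exp (-(2 * alpha η j * x)) * Real.exp (2 * ℓ * (alpha η (j - 1) * y)) * F ≤
      Real.exp (-(η / (2 * (j : ℝ) ^ 2) * x)) * Real.exp (Real.log (I.Q (j - 1)) / 2) *
        Real.log (I.Q j) ^ 4 * Real.exp 6 := hexp
  -- numeric: `e^{6 + 1/48} ≤ e^7`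
  have he7 : Real.exp (1 / 48) * Real.exp 6 ≤ Real.exp 7 := by
    rw [← Real.exp_add]; exact Real.exp_le_exp.2 (by norm_num)
  calc ∫ t in I.Tsub c T₀ T j r,
        ‖blockPrimePoly c (I.P j) (I.Q j) (I.Hpar j) v t *
          blockCofactorPoly (b) X (I.P j) (I.Q j) (I.Hpar j) v t‖ ^ 2
      ≤ max C₁₃ 0 * (T / X + 1) * Real.exp y *
          (Real.exp (-(η / (2 * (j : ℝ) ^ 2) * x)) * Real.exp (Real.log (I.Q (j - 1)) / 2) *
            Real.log (I.Q j) ^ 4 * Real.exp 6) :=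
        hmain'.trans (mul_le_mul_of_nonneg_left hexp' (by positivity))
    _ ≤ max C₁₃ 0 * (T / X + 1) * I.Q (j - 1) *
          ((Real.exp (1 / 48) * (I.Q (j - 1) ^ 4 * (j : ℝ) ^ 8)⁻¹) * I.Q (j - 1) ^ (1 / 2 : ℝ) *
            I.Q (j - 1) ^ (4 / 96 : ℝ) * Real.exp 6) := by
        rw [heL'] at *
        gcongr
    _ = max C₁₃ 0 * (T / X + 1) * ((Real.exp (1 / 48) * Real.exp 6) / (j : ℝ) ^ 8 *
          (I.Q (j - 1) * (I.Q (j - 1) ^ (1 / 2 : ℝ) * I.Q (j - 1) ^ (4 / 96 : ℝ)) * (I.Q (j - 1) ^ 4)⁻¹)) := by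
        field_simp
    _ ≤ max C₁₃ 0 * (T / X + 1) * (Real.exp 7 / (j : ℝ) ^ 8 * I.Q (j - 1) ^ (-(59 / 24) : ℝ)) := by
        rw [rpow_aux hA]
        gcongr

/-! ### The bound for `E_j`, `j ≥ 2`, general coefficients -/

/-- **§8.2, the bound for `E_j` (`2 ≤ j`)**: with `C₁₂ = 20000` and the constant `C₁₃` of Lemma 13, for
`0 < η < 1/6`, `H₁ ≥ 2`, `X, T ≥ 1`, `T₀ ≥ 0`,
`C₁₂ H_j log(Q_j/P_j) ∑_{v∈ℐ_j} ∫_{𝒯_j} |Q_{v,H_j} R_{v,H_j}|² ≤ 10⁸ max(C₁₃,0) (T/X + 1)/(j² Q_{j-1})`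
(the paper: "`E_j ≪ (T/X + 1) j⁶ Q_{j-1}³ exp(-(η/(2j²)) log P_j) ≪ (T/X + 1)/(j² Q_{j-1}) ≪ (T/X + 1)/(j² P_1)`").
[cite: MatomakiRadziwillAnnals2016, §8.2] -/
theorem E_j_le_coef {C₁₃ : ℝ}
    (h13 : ∀ (X T Y₁ Y₂ : ℝ) (a c : ℕ → ℂ), 1 ≤ X → 1 ≤ T → 2 ≤ Y₁ → 1 ≤ Y₂ →
      (∀ m, ‖a m‖ ≤ 1) → (∀ p, ‖c p‖ ≤ 1) →
      ∫ t in (-T)..T,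
          ‖(∑ p ∈ (Icc ⌈Y₁⌉₊ ⌊2 * Y₁⌋₊).filter Nat.Prime, c p * (p : ℂ) ^ (-(1 + (t : ℂ) * Complex.I)))
                ^ ⌈Real.log Y₂ / Real.log Y₁⌉₊
            * ∑ m ∈ Icc ⌈X / Y₂⌉₊ ⌊2 * X / Y₂⌋₊, a m * (m : ℂ) ^ (-(1 + (t : ℂ) * Complex.I))‖ ^ 2 ≤
        C₁₃ * (T / X + 2 ^ ⌈Real.log Y₂ / Real.log Y₁⌉₊ * Y₁)
          * ((⌈Real.log Y₂ / Real.log Y₁⌉₊ + 1).factorial : ℝ) ^ 2)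
    (hη : 0 < η) (hη6 : η < 1 / 6) (c b : ℕ → ℂ) (hc : ∀ p, ‖c p‖ ≤ 1) (hb : ∀ m, ‖b m‖ ≤ 1) {X : ℝ} (hX : 1 ≤ X)
    {T₀ T : ℝ} (hT₀ : 0 ≤ T₀) (hT : 1 ≤ T) {j : ℕ} (hj : 2 ≤ j) (hH1 : 2 ≤ I.Hpar 1) :
    20000 * ((I.Hpar j * Real.log (I.Q j / I.P j)) *
        (∑ v ∈ I.blocks j, ∫ t in I.Tset c T₀ T j,
          ‖blockPrimePoly c (I.P j) (I.Q j) (I.Hpar j) v t *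
            blockCofactorPoly (b) X (I.P j) (I.Q j) (I.Hpar j) v t‖ ^ 2)) ≤
      100000000 * max C₁₃ 0 * (T / X + 1) / ((j : ℝ) ^ 2 * I.Q (j - 1)) := by
  have hη' : η ≤ 8 := by linarith
  have hη'' : η ≤ 1 / 6 := hη6.le
  have hj1 : 1 ≤ j - 1 := by omega
  have hjj : 1 ≤ j := by omega
  have hj2 : (2 : ℝ) ≤ j := by exact_mod_cast hj
  have hHj1 : 2 ≤ I.Hpar j := hH1.trans (I.Hpar_one_le hη hη' hjj)
  have hHi1 : 2 ≤ I.Hpar (j - 1) := hH1.trans (I.Hpar_one_le hη hη' hj1)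
  have hHj0 : 0 < I.Hpar j := by linarith
  have hA : 0 < I.Q (j - 1) := I.pos_Q hj1
  have hA1 : 1 ≤ I.Q (j - 1) := I.one_le_Q hη hη' hj1
  have hQ : 0 < I.Q j := I.pos_Q hjj
  have hP : 0 < I.P j := I.pos_P j hjj
  have hlogA : 1 < Real.log (I.Q (j - 1)) := I.one_lt_logQ hη hη'' hj1
  have hL : 1 < Real.log (I.Q j) := I.one_lt_logQ hη hη'' hjj
  have hT0 : 0 < T := by linarith
  have hX0 : 0 < X := by linarith
  set B := max C₁₃ 0 * (T / X + 1) * (Real.exp 7 / (j : ℝ) ^ 8 * I.Q (j - 1) ^ (-(59 / 24) : ℝ)) with hB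
  have hB0 : 0 ≤ B := by positivity
  -- split `∫_{𝒯_j}` along the `𝒯_{j,r}` and bound each piece by `B`
  have hsum : ∑ v ∈ I.blocks j, ∫ t in I.Tset c T₀ T j,
      ‖blockPrimePoly c (I.P j) (I.Q j) (I.Hpar j) v t *
        blockCofactorPoly (b) X (I.P j) (I.Q j) (I.Hpar j) v t‖ ^ 2 ≤
      #(I.blocks j) * (#(I.blocks (j - 1)) * B) := by
    rw [← nsmul_eq_mul, ← sum_const]
    refine sum_le_sum fun v hv => ?_
    have hcont : Continuous fun t => ‖blockPrimePoly c (I.P j) (I.Q j) (I.Hpar j) v t *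
        blockCofactorPoly (b) X (I.P j) (I.Q j) (I.Hpar j) v t‖ ^ 2 := by
      refine ((Continuous.mul ?_ ?_).norm).pow 2
      · unfold blockPrimePoly; exact MatomakiRadziwillLemma12.continuous_dsum _ _
      · unfold blockCofactorPoly
        exact continuous_finsetSum _ fun m _ =>
          (continuous_const.mul (MatomakiRadziwillLemma12.continuous_cpw m)).div_const _
    have hsubT : I.Tset c T₀ T j ⊆ Set.Icc (-T) T :=
      (I.Tset_subset c T₀ T j).trans (Set.Icc_subset_Icc (by linarith) le_rfl)
    rw [I.integral_Tset_eq_sum_Tsub c T₀ T hj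
      (MatomakiRadziwillLemma12.integrableOn_of_continuous hcont hsubT), ← nsmul_eq_mul, ← sum_const]
    refine sum_le_sum fun r hr => ?_
    exact I.integral_Tsub_le_coef' h13 hη hη6 c b hc hb hX hT₀ hT hj hH1 hr hv
  -- sizes
  have hIj : (#(I.blocks j) : ℝ) ≤ 2 * (I.Hpar j * Real.log (I.Q j)) :=
    I.card_blocks_le hη hη'' hjj (by linarith)
  have hIi : (#(I.blocks (j - 1)) : ℝ) ≤ 2 * (I.Hpar j * Real.log (I.Q j)) := by
    refine (I.card_blocks_le hη hη'' hj1 (by linarith)).trans ?_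
    have h1 : I.Hpar (j - 1) ≤ I.Hpar j := by
      rw [I.Hpar_eq (j - 1), I.Hpar_eq j]
      have : ((j - 1 : ℕ) : ℝ) ^ 2 ≤ (j : ℝ) ^ 2 := by
        have h0 : ((j - 1 : ℕ) : ℝ) ≤ j := by exact_mod_cast Nat.sub_le j 1
        exact pow_le_pow_left₀ (Nat.cast_nonneg _) h0 2
      exact mul_le_mul_of_nonneg_right this (I.Hpar_one_pos hη hη').le
    have h2 : Real.log (I.Q (j - 1)) ≤ Real.log (I.Q j) := by
      refine Real.log_le_log hA ?_
      have := I.Q_lt_Q hη hη' hj1 (show j - 1 < j by omega)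
      exact this.le
    have : I.Hpar (j - 1) * Real.log (I.Q (j - 1)) ≤ I.Hpar j * Real.log (I.Q j) :=
      mul_le_mul h1 h2 (by linarith) hHj0.le
    linarith
  have hlogQP : Real.log (I.Q j / I.P j) ≤ Real.log (I.Q j) := by
    rw [Real.log_div hQ.ne' hP.ne']
    linarith [I.two_le_logP hη hη'' hjj]
  have hlogQP0 : 0 ≤ Real.log (I.Q j / I.P j) := by
    rw [Real.log_div hQ.ne' hP.ne']
    linarith [Real.log_le_log hP (I.P_le_Q j hjj)]
  have hH3 : I.Hpar j ^ 3 ≤ (j : ℝ) ^ 6 * I.Q (j - 1) ^ (1 / 2 : ℝ) := by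
    refine (I.Hpar_cube_le hη hη'' j).trans ?_
    exact mul_le_mul_of_nonneg_left
      (Real.rpow_le_rpow (I.pos_P 1 le_rfl).le (I.P_one_le_Q_pred hη hη' hj) (by norm_num))
      (by positivity)
  have hL3 : Real.log (I.Q j) ^ 3 ≤ I.Q (j - 1) ^ (3 / 96 : ℝ) := by
    have h := I.logQ_le_Q_pred_rpow hη hη'' hj
    calc Real.log (I.Q j) ^ 3 ≤ (I.Q (j - 1) ^ (1 / 96 : ℝ)) ^ 3 := pow_le_pow_left₀ (by linarith) h 3
      _ = I.Q (j - 1) ^ (3 / 96 : ℝ) := by rw [← Real.rpow_natCast, ← Real.rpow_mul hA.le]; norm_num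
  -- the main product
  set HL := I.Hpar j * Real.log (I.Q j) with hHL
  have hHL0 : 0 ≤ HL := by positivity
  have hprod : 20000 * ((I.Hpar j * Real.log (I.Q j / I.P j)) *
      (∑ v ∈ I.blocks j, ∫ t in I.Tset c T₀ T j,
        ‖blockPrimePoly c (I.P j) (I.Q j) (I.Hpar j) v t *
          blockCofactorPoly (b) X (I.P j) (I.Q j) (I.Hpar j) v t‖ ^ 2)) ≤
      80000 * HL ^ 3 * B := by
    have h1 : I.Hpar j * Real.log (I.Q j / I.P j) ≤ HL := mul_le_mul_of_nonneg_left hlogQP hHj0.le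
    have h2 : (∑ v ∈ I.blocks j, ∫ t in I.Tset c T₀ T j,
        ‖blockPrimePoly c (I.P j) (I.Q j) (I.Hpar j) v t *
          blockCofactorPoly (b) X (I.P j) (I.Q j) (I.Hpar j) v t‖ ^ 2) ≤ (2 * HL) * ((2 * HL) * B) :=
      hsum.trans (mul_le_mul hIj (mul_le_mul_of_nonneg_right hIi hB0) (by positivity) (by positivity))
    have h0 : 0 ≤ ∑ v ∈ I.blocks j, ∫ t in I.Tset c T₀ T j,
        ‖blockPrimePoly c (I.P j) (I.Q j) (I.Hpar j) v t *
          blockCofactorPoly (b) X (I.P j) (I.Q j) (I.Hpar j) v t‖ ^ 2 :=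
      sum_nonneg fun v _ => integral_nonneg fun t => by positivity
    calc 20000 * ((I.Hpar j * Real.log (I.Q j / I.P j)) * _)
        ≤ 20000 * (HL * ((2 * HL) * ((2 * HL) * B))) := by
          gcongr 20000 * ?_
          exact mul_le_mul h1 h2 h0 hHL0
      _ = 80000 * HL ^ 3 * B := by ring
  have hHL3 : HL ^ 3 ≤ (j : ℝ) ^ 6 * (I.Q (j - 1) ^ (1 / 2 : ℝ) * I.Q (j - 1) ^ (3 / 96 : ℝ)) := by
    rw [hHL, mul_pow]
    calc I.Hpar j ^ 3 * Real.log (I.Q j) ^ 3 ≤ ((j : ℝ) ^ 6 * I.Q (j - 1) ^ (1 / 2 : ℝ)) * I.Q (j - 1) ^ (3 / 96 : ℝ) :=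
          mul_le_mul hH3 hL3 (by positivity) (by positivity)
      _ = _ := by ring
  -- rpow bookkeeping: `A^{1/2} A^{3/96} A^{-59/24} = A^{-185/96} ≤ A^{-1}`
  have hrpow : I.Q (j - 1) ^ (1 / 2 : ℝ) * I.Q (j - 1) ^ (3 / 96 : ℝ) * I.Q (j - 1) ^ (-(59 / 24) : ℝ) ≤
      (I.Q (j - 1))⁻¹ := by
    rw [← Real.rpow_add hA, ← Real.rpow_add hA, ← Real.rpow_neg_one]
    refine Real.rpow_le_rpow_of_exponent_le hA1 ?_
    norm_num
  calc 20000 * ((I.Hpar j * Real.log (I.Q j / I.P j)) *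
        (∑ v ∈ I.blocks j, ∫ t in I.Tset c T₀ T j,
          ‖blockPrimePoly c (I.P j) (I.Q j) (I.Hpar j) v t *
            blockCofactorPoly (b) X (I.P j) (I.Q j) (I.Hpar j) v t‖ ^ 2))
      ≤ 80000 * HL ^ 3 * B := hprod
    _ ≤ 80000 * ((j : ℝ) ^ 6 * (I.Q (j - 1) ^ (1 / 2 : ℝ) * I.Q (j - 1) ^ (3 / 96 : ℝ))) * B := by gcongr
    _ = 80000 * Real.exp 7 * max C₁₃ 0 * (T / X + 1) *
          ((I.Q (j - 1) ^ (1 / 2 : ℝ) * I.Q (j - 1) ^ (3 / 96 : ℝ) * I.Q (j - 1) ^ (-(59 / 24) : ℝ)) /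
            (j : ℝ) ^ 2) := by
        rw [hB]
        field_simp
    _ ≤ 80000 * 1100 * max C₁₃ 0 * (T / X + 1) * ((I.Q (j - 1))⁻¹ / (j : ℝ) ^ 2) := by
        gcongr
        exact exp_seven_le
    _ ≤ 100000000 * max C₁₃ 0 * (T / X + 1) / ((j : ℝ) ^ 2 * I.Q (j - 1)) := by
        rw [show 100000000 * max C₁₃ 0 * (T / X + 1) / ((j : ℝ) ^ 2 * I.Q (j - 1)) =
          100000000 * max C₁₃ 0 * (T / X + 1) * ((I.Q (j - 1))⁻¹ / (j : ℝ) ^ 2) by field_simp]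
        gcongr
        norm_num


end SieveIntervalSystem

end Literature.NumberTheory.Sieve
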